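import Mathlib

/-!
# T6N3GramRow — vectors in `ℓ²(ι)` with a prescribed cross-Gram matrix and a prescribed proportionality

Cell pub-hodge-repro2, Tier 6 (README §10), seat t6-p3 (N3 owner, M2). Proof lane; count-neutral;
`import Mathlib` only. THE REPAIR OF THE (S7) SEAM (STATUS l. 11352 (3)), in generic form. Given a
finite index set, a distinguished index `p₀ ∈ S`, a «block» `Λ : ι → κ → ℂ` and a distinguished
column `q₀` with `Λ p₀ q₀ ≠ 0`, the vectors
* `uVec p := single p₀ 1` for `p = p₀`, `(Λ p q₀ / Λ p₀ q₀) • single p₀ 1 + single p 1` otherwise,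
* `vVec q := Σ_{r ∈ S} conj (yCoef r q) • single r 1` with `yCoef p₀ q := Λ p₀ q` and
  `yCoef r q := Λ r q − Λ p₀ q * Λ r q₀ / Λ p₀ q₀` for `r ≠ p₀`
of `EuclideanSpace ℂ ι` satisfy `⟪vVec q, uVec p⟫ = Λ p q` for every `p ∈ S` and every `q`
(`inner_vVec_uVec`) AND `vVec q₀ = conj (Λ p₀ q₀) • uVec p₀` (`vVec_q₀`): the column `q₀` is realised
on the LINE of `uVec p₀`. For the N1 witness (t6-p1, T6N1WitGram) this is the dictionary `sc` on the
first-copy pairs (`S := pairs1 F`, `uVec`) and on the second-copy pairs (`vVec`) with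
`Λ p q := λ₁(e_p · conj2 e_q)`, `p₀ := the pair of ω_A`, `q₀ := the pair of ω_B`: the `(★)` block holds
by construction and `sc ω_B ∝ sc ω_A`, as the N3 seam requires (T6N3TrivGroup,
`span_eq_of_products_on_lines`).

§8(d): uses an L-value-free non-vanishing device: NO.
-/

namespace Summit.Ventures.HodgeRepro2.T6.GramRow

open scoped InnerProductSpace

variable {ι : Type*} [DecidableEq ι] {κ : Type*}

/-- The row vectors: `single p₀ 1` at `p₀`, `(Λ p q₀ / Λ p₀ q₀) • single p₀ 1 + single p 1` elsewhere. -/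
noncomputable def uVec (p₀ : ι) (Λ : ι → κ → ℂ) (q₀ : κ) (p : ι) : EuclideanSpace ℂ ι :=
  if p = p₀ then EuclideanSpace.single p₀ 1
  else (Λ p q₀ / Λ p₀ q₀) • EuclideanSpace.single p₀ 1 + EuclideanSpace.single p 1

/-- The coordinates of the column vectors. -/
noncomputable def yCoef (p₀ : ι) (Λ : ι → κ → ℂ) (q₀ : κ) (r : ι) (q : κ) : ℂ :=
  if r = p₀ then Λ p₀ q else Λ r q - Λ p₀ q * Λ r q₀ / Λ p₀ q₀

/-- The column vectors: `Σ_{r ∈ S} conj (yCoef r q) • single r 1`. -/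
noncomputable def vVec (S : Finset ι) (p₀ : ι) (Λ : ι → κ → ℂ) (q₀ : κ) (q : κ) :
    EuclideanSpace ℂ ι :=
  ∑ r ∈ S, (starRingEnd ℂ) (yCoef p₀ Λ q₀ r q) • EuclideanSpace.single r 1

/-- `uVec p₀ = single p₀ 1`. -/
theorem uVec_p₀ (p₀ : ι) (Λ : ι → κ → ℂ) (q₀ : κ) : uVec p₀ Λ q₀ p₀ = EuclideanSpace.single p₀ 1 := by
  simp [uVec]

/-- `⟪vVec q, single p 1⟫ = yCoef p q` for `p ∈ S`. -/
theorem inner_vVec_single [Fintype ι] (S : Finset ι) (p₀ : ι) (Λ : ι → κ → ℂ) (q₀ : κ) (q : κ) {p : ι}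
    (hp : p ∈ S) : ⟪vVec S p₀ Λ q₀ q, EuclideanSpace.single p 1⟫_ℂ = yCoef p₀ Λ q₀ p q := by
  rw [vVec, sum_inner, Finset.sum_eq_single_of_mem p hp]
  · rw [inner_smul_left, EuclideanSpace.inner_single_left, PiLp.single_apply, if_pos rfl]
    simp
  · intro r _ hr
    rw [inner_smul_left, EuclideanSpace.inner_single_left, PiLp.single_apply, if_neg hr]
    simp

/-- THE CROSS-GRAM IDENTITY: `⟪vVec q, uVec p⟫ = Λ p q` for every `p ∈ S` and every `q`. -/
theorem inner_vVec_uVec [Fintype ι] (S : Finset ι) {p₀ : ι} (hp₀ : p₀ ∈ S) (Λ : ι → κ → ℂ) {q₀ : κ}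
    (h0 : Λ p₀ q₀ ≠ 0) (q : κ) {p : ι} (hp : p ∈ S) :
    ⟪vVec S p₀ Λ q₀ q, uVec p₀ Λ q₀ p⟫_ℂ = Λ p q := by
  by_cases hpp : p = p₀
  · subst hpp
    rw [uVec_p₀, inner_vVec_single S p Λ q₀ q hp, yCoef, if_pos rfl]
  · rw [uVec, if_neg hpp, inner_add_right, inner_smul_right, inner_vVec_single S p₀ Λ q₀ q hp₀,
      inner_vVec_single S p₀ Λ q₀ q hp, yCoef, if_pos rfl, yCoef, if_neg hpp]
    field_simp
    ring

/-- THE PROPORTIONALITY: the column `q₀` is `conj (Λ p₀ q₀) • uVec p₀`. -/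
theorem vVec_q₀ (S : Finset ι) {p₀ : ι} (hp₀ : p₀ ∈ S) (Λ : ι → κ → ℂ) {q₀ : κ}
    (h0 : Λ p₀ q₀ ≠ 0) :
    vVec S p₀ Λ q₀ q₀ = (starRingEnd ℂ) (Λ p₀ q₀) • uVec p₀ Λ q₀ p₀ := by
  rw [uVec_p₀, vVec, Finset.sum_eq_single_of_mem p₀ hp₀]
  · rw [yCoef, if_pos rfl]
  · intro r _ hr
    rw [yCoef, if_neg hr]
    have : Λ r q₀ - Λ p₀ q₀ * Λ r q₀ / Λ p₀ q₀ = 0 := by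
      field_simp
      ring
    rw [this, map_zero, zero_smul]

/-- `vVec q₀` lies on the line of `uVec p₀`. -/
theorem vVec_q₀_mem_span (S : Finset ι) {p₀ : ι} (hp₀ : p₀ ∈ S) (Λ : ι → κ → ℂ) {q₀ : κ}
    (h0 : Λ p₀ q₀ ≠ 0) : vVec S p₀ Λ q₀ q₀ ∈ ℂ ∙ uVec p₀ Λ q₀ p₀ := by
  rw [vVec_q₀ S hp₀ Λ h0]
  exact Submodule.smul_mem _ _ (Submodule.mem_span_singleton_self _)

/-- `uVec p₀ ≠ 0`. -/
theorem uVec_p₀_ne_zero (p₀ : ι) (Λ : ι → κ → ℂ) (q₀ : κ) : uVec p₀ Λ q₀ p₀ ≠ 0 := by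
  rw [uVec_p₀]
  intro h
  have := congrFun (congrArg (fun v : EuclideanSpace ℂ ι => (v : ι → ℂ)) h) p₀
  simp at this

/-- `vVec q₀ ≠ 0`. -/
theorem vVec_q₀_ne_zero (S : Finset ι) {p₀ : ι} (hp₀ : p₀ ∈ S) (Λ : ι → κ → ℂ) {q₀ : κ}
    (h0 : Λ p₀ q₀ ≠ 0) : vVec S p₀ Λ q₀ q₀ ≠ 0 := by
  rw [vVec_q₀ S hp₀ Λ h0]
  exact smul_ne_zero ((map_ne_zero _).mpr h0) (uVec_p₀_ne_zero p₀ Λ q₀)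

/-- The pairing of the two distinguished vectors is `Λ p₀ q₀` (non-zero). -/
theorem inner_vVec_q₀_uVec_p₀ [Fintype ι] (S : Finset ι) {p₀ : ι} (hp₀ : p₀ ∈ S) (Λ : ι → κ → ℂ) {q₀ : κ}
    (h0 : Λ p₀ q₀ ≠ 0) : ⟪vVec S p₀ Λ q₀ q₀, uVec p₀ Λ q₀ p₀⟫_ℂ = Λ p₀ q₀ :=
  inner_vVec_uVec S hp₀ Λ h0 q₀ hp₀

end Summit.Ventures.HodgeRepro2.T6.GramRow
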